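import Literature.NumberTheory.Automorphic.ArchWallOrthantFunctionalSmooth     -- ★ (this seat): (D) `contDiffOn_torusFunctional`, (C) `fderiv_torusFunctional_inr_eqOn`, `contDiff_tangentialDeriv`; brings ★ `IteratedFDerivWords`
import HarnessLib

/-!
# JETS OF THE `k`-FOLD NORMALISED ORBITAL FUNCTIONAL `F(ψ, d) = (∏ᵢ 2 sin ψᵢ) · ∫ g(d, (hᵢ Tᵢ(ψᵢ) hᵢ⁻¹)ᵢ) d(⊗ᵢ νᵢ)` FROM THE ENGINE'S `ψ`-SECTION BOUNDS
# (stage (α4-S5♭) «tangential closure + family assembly», part 2; Varadarajan 1989 §6.4, Bouaziz 1994 §3.1 (I₂), Hörmander I §1.1)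

Topic `NumberTheory/Automorphic`; namespace `Literature.NumberTheory.Automorphic.UnitaryGroup`.  THEOREMS ONLY (no `def`, no instance, no notation, no axiom, no `sorry`).
Cell `pub/hodgecm-mathlib`, crux H413 (`stmt-HodgeConjecture-24833`), line LH3 (closer stub `stub_N9`, DIRECT ROAD), letter L3′ organ O-L3′ conjunct (ii) for GENERAL `fH`
(`h2` of ★ `archBzSmoothBounded_stOrbFamH_of_slab_zero`), (α4) «all-orders transport».  Author LH3-p01 (g5).  Count-neutral.  Setting and notation as in ★ `ArchWallOrthantFunctionalSmooth`
(torus curves `T_i` abstract with `hTs`∕`hTp`; smooth parameters `d ∈ V`; integrand `g : V × (ι → M₂(ℂ)) → E` jointly `C^∞`, `K`-supported; functional `F` given by `hF`).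
* §4 **NORMAL FORM OF MIXED WORDS** (`exists_psiWord_eqOn_word_torusFunctional`): with the product basis `b = (Pi.basisFun ℝ ι).prod bV` of `(ι → ℝ) × V`, every word `word_{b∘l} F` equals on
  `U = {∀ i, sin ψᵢ ≠ 0}` a pure `ψ`-word `word_{σ♯} F′` of the functional `F′ = F[g′]` of an iterated tangential derivative `g′` of `g` (★ Schwarz for words + ★ (C) + locality of words).
* §5 **HEAD `exists_forall_norm_iteratedFDeriv_torusFunctional_le`**: IF the engine bounds the `ψ`-SECTION jets on basis tuples near the walls — `hInv : ∀ g′ (C^∞, K-supported) n σ ε, ∃ δ > 0, ∃ B,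
  ∀ d ∈ K₁, ∀ ψ in the open `ε`-orthant `δ`-cube, ‖iteratedFDeriv ℝ n (ψ′ ↦ F[g′](ψ′, d)) ψ (Pi.single ∘ σ)‖ ≤ B` (the conclusion of LH10-p01's `Inv ι`, (α4-S6), read at `P := ↥K₁`,
  `Q := V`, `Φ := g′`) — THEN **`∀ n, ∃ δ > 0, ∃ B, ∀ d ∈ K₁, ∀ ψ, (∀ i, 0 < |ψᵢ| < δ) → ‖iteratedFDeriv ℝ n F (ψ, d)‖ ≤ B`**: ALL jets of the joint functional are bounded near the corner,
  uniformly in the smooth parameters (§4 + ★ `norm_foldr_dirDeriv_inl_eq_norm_iteratedFDeriv_section` + ★ order-zero reduction over the product basis; `min`∕`max` over the finitely many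
  words and the `2^k` sign orthants; `exists_forall_norm_foldr_torusFunctional_le` is the one-word form).
HONEST LABEL: HC_CM is proved only modulo the 7 printed citations (2 remaining: hLiu418 = stmt-HodgeConjecture-24832, h413 = stmt-HodgeConjecture-24833) until rung 0 closes; this
file is the calculus between the `k`-fold engine (`Inv ι`, LH10-p01, in flight) and the `h2` assembly ((α4-S7)), and pays nothing by itself.

## References
* [Varadarajan1989] V. S. Varadarajan, *An Introduction to Harmonic Analysis on Semisimple Lie Groups*, Cambridge Stud. Adv. Math. 16 (1989), §6.4 Thms 22–24.
* [Bouaziz1994IntegralesOrbitales] A. Bouaziz, *Intégrales orbitales sur les algèbres de Lie réductives*, Invent. Math. 115 (1994), §3.1 (I₂) p. 579.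
* [HormanderALPDO1] L. Hörmander, *The Analysis of Linear Partial Differential Operators I*, 2nd ed. (1990), §1.1 Thms. 1.1.6–1.1.9 (pp. 7–12).
* [Rogawski1990] J. D. Rogawski, *Automorphic Representations of Unitary Groups in Three Variables*, Ann. of Math. Stud. 123 (1990), §8.2 pp. 119–122.
-/

set_option autoImplicit false

noncomputable section

open MeasureTheory Measure Filter Topology Set Function NumberField NumberField.InfinitePlace Matrix Complex
open Literature.NumberTheory.Automorphic Literature.NumberTheory.Automorphic.ArchCartan Literature.Analysis.Calculus
open scoped ContDiff MatrixGroups Matrix ENNReal NNReal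
open scoped Matrix.Norms.Operator

namespace Literature.NumberTheory.Automorphic.UnitaryGroup

/-! ## §4 Normal form of mixed words; §5 the head: all jets from the engine's `ψ`-section bounds -/

section Jets

variable (L : Type) [Field L] {ι : Type*} [Fintype ι] [DecidableEq ι] (wl : ι → {w : InfinitePlace L // IsComplex w})
  [∀ i, MeasurableSpace ↥(archLocal L 2 (Matrix.of fun i j : Fin 2 => if i.val + j.val + 1 = 2 then (1 : L) else 0) (wl i))]
  [∀ i, BorelSpace ↥(archLocal L 2 (Matrix.of fun i j : Fin 2 => if i.val + j.val + 1 = 2 then (1 : L) else 0) (wl i))]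
  (ν : ∀ i, Measure ↥(archLocal L 2 (Matrix.of fun i j : Fin 2 => if i.val + j.val + 1 = 2 then (1 : L) else 0) (wl i)))
  [∀ i, IsFiniteMeasureOnCompacts (ν i)] [∀ i, SigmaFinite (ν i)]
  (T : ∀ i, ℝ → ↥(archLocal L 2 (Matrix.of fun i j : Fin 2 => if i.val + j.val + 1 = 2 then (1 : L) else 0) (wl i)))
  (hTs : ∀ i, ContDiff ℝ ∞ fun ψ : ℝ => (((T i ψ : ↥(archLocal L 2 (Matrix.of fun i j : Fin 2 => if i.val + j.val + 1 = 2 then (1 : L) else 0) (wl i))) :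
    GL (Fin 2) ℂ) : Matrix (Fin 2) (Fin 2) ℂ))
  (hTp : ∀ i (Kψ : Set ℝ), IsCompact Kψ → (∀ ψ ∈ Kψ, Real.sin ψ ≠ 0) →
    ∀ C : Set ↥(archLocal L 2 (Matrix.of fun i j : Fin 2 => if i.val + j.val + 1 = 2 then (1 : L) else 0) (wl i)), IsCompact C →
      ∃ 𝒞 : Set ↥(archLocal L 2 (Matrix.of fun i j : Fin 2 => if i.val + j.val + 1 = 2 then (1 : L) else 0) (wl i)), IsCompact 𝒞 ∧
        ∀ y, ∀ ψ ∈ Kψ, y * T i ψ * y⁻¹ ∈ C → y ∈ 𝒞)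
  {V : Type*} [NormedAddCommGroup V] [NormedSpace ℝ V] [FiniteDimensional ℝ V] {κ : Type*} (bV : Module.Basis κ ℝ V)
  {E : Type*} [NormedAddCommGroup E] [NormedSpace ℝ E] [CompleteSpace E]
  {K : Set (ι → Matrix (Fin 2) (Fin 2) ℂ)} (hK : IsCompact K)

include hTs hTp hK

/-- **NORMAL FORM OF MIXED WORDS**: for the product basis `b = (Pi.basisFun ℝ ι).prod bV` of `(ι → ℝ) × V` and every word `l` in its vectors, there are a pure `ψ`-word `σ` and an integrand `g′`
(an iterated tangential derivative of `g`: jointly `C^∞`, same `Y`-support) with functional `F′ = F[g′]` such that `word_{b∘l} F = word_{σ♯} F′` on `U = {∀ i, sin ψᵢ ≠ 0}` — the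
`d`-letters move inside by ★ Schwarz for words and act on the integrand by (C). [cite: HormanderALPDO1, §1.1 Thms. 1.1.8–1.1.9] [cite: Varadarajan1989, §6.4 Thm 23] -/
theorem exists_psiWord_eqOn_word_torusFunctional {g : V × (ι → Matrix (Fin 2) (Fin 2) ℂ) → E} (hg : ContDiff ℝ ∞ g) (hg0 : ∀ d, ∀ Y ∉ K, g (d, Y) = 0)
    {F : (ι → ℝ) × V → E} (hF : ∀ ψ d, F (ψ, d) = (∏ i, 2 * Real.sin (ψ i)) •
      ∫ h : (∀ i, ↥(archLocal L 2 (Matrix.of fun i j : Fin 2 => if i.val + j.val + 1 = 2 then (1 : L) else 0) (wl i))),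
        g (d, fun i => (((h i * T i (ψ i) * (h i)⁻¹ : ↥(archLocal L 2 _ (wl i))) : GL (Fin 2) ℂ) : Matrix (Fin 2) (Fin 2) ℂ)) ∂(Measure.pi ν))
    (l : List (ι ⊕ κ)) :
    ∃ (σ : List ι) (g' : V × (ι → Matrix (Fin 2) (Fin 2) ℂ) → E) (F' : (ι → ℝ) × V → E), ContDiff ℝ ∞ g' ∧ (∀ d, ∀ Y ∉ K, g' (d, Y) = 0) ∧
      (∀ ψ d, F' (ψ, d) = (∏ i, 2 * Real.sin (ψ i)) •
        ∫ h : (∀ i, ↥(archLocal L 2 (Matrix.of fun i j : Fin 2 => if i.val + j.val + 1 = 2 then (1 : L) else 0) (wl i))),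
          g' (d, fun i => (((h i * T i (ψ i) * (h i)⁻¹ : ↥(archLocal L 2 _ (wl i))) : GL (Fin 2) ℂ) : Matrix (Fin 2) (Fin 2) ℂ)) ∂(Measure.pi ν)) ∧
      EqOn ((l.map fun s => (((Pi.basisFun ℝ ι).prod bV) s : (ι → ℝ) × V)).foldr (fun v h y => fderiv ℝ h y v) F)
        ((σ.map fun i => ((Pi.single i (1 : ℝ) : ι → ℝ), (0 : V))).foldr (fun v h y => fderiv ℝ h y v) F') {x | ∀ i, Real.sin (x.1 i) ≠ 0} := by
  have hU : IsOpen {x : (ι → ℝ) × V | ∀ i, Real.sin (x.1 i) ≠ 0} := by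
    have h : {x : (ι → ℝ) × V | ∀ i, Real.sin (x.1 i) ≠ 0} = ⋂ i, (fun x : (ι → ℝ) × V => Real.sin (x.1 i)) ⁻¹' {0}ᶜ := by ext x; simp
    rw [h]
    exact isOpen_iInter_of_finite fun i => (Real.continuous_sin.comp ((continuous_apply i).comp continuous_fst)).isOpen_preimage _ isOpen_compl_singleton
  have hb_inl : ∀ i : ι, (((Pi.basisFun ℝ ι).prod bV) (Sum.inl i) : (ι → ℝ) × V) = ((Pi.single i (1 : ℝ) : ι → ℝ), (0 : V)) := fun i =>
    Prod.ext (by simp) (by simp)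
  have hb_inr : ∀ j : κ, (((Pi.basisFun ℝ ι).prod bV) (Sum.inr j) : (ι → ℝ) × V) = ((0 : ι → ℝ), bV j) := fun j =>
    Prod.ext (by simp) (by simp)
  induction l with
  | nil => exact ⟨[], g, F, hg, hg0, hF, fun x _ => by simp⟩
  | cons s l ih =>
    obtain ⟨σ, g', F', hg', hg0', hF', heq⟩ := ih
    have h1 : EqOn (fun y => fderiv ℝ ((l.map fun s => (((Pi.basisFun ℝ ι).prod bV) s : (ι → ℝ) × V)).foldr (fun v h y => fderiv ℝ h y v) F) y (((Pi.basisFun ℝ ι).prod bV) s))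
        (fun y => fderiv ℝ ((σ.map fun i => ((Pi.single i (1 : ℝ) : ι → ℝ), (0 : V))).foldr (fun v h y => fderiv ℝ h y v) F') y (((Pi.basisFun ℝ ι).prod bV) s))
        {x | ∀ i, Real.sin (x.1 i) ≠ 0} := dirDeriv_eqOn_of_eqOn hU heq _
    cases s with
    | inl i =>
      refine ⟨i :: σ, g', F', hg', hg0', hF', ?_⟩
      rw [List.map_cons, List.foldr_cons, List.map_cons, List.foldr_cons]
      rw [hb_inl] at h1 ⊢
      exact h1
    | inr j =>
      -- the tangential letter moves inside (Schwarz for words) and acts on the integrand (C)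
      have hF's : ContDiffOn ℝ ∞ F' {x | ∀ i, Real.sin (x.1 i) ≠ 0} := contDiffOn_torusFunctional L wl ν T hTs hTp hK hg' hg0' hF'
      obtain ⟨hg'', hg0''⟩ := contDiff_tangentialDeriv (K := K) hg' hg0' (bV j)
      refine ⟨σ, fun q => fderiv ℝ (fun d => g' (d, q.2)) q.1 (bV j), fun x => (∏ i, 2 * Real.sin (x.1 i)) •
        ∫ h : (∀ i, ↥(archLocal L 2 (Matrix.of fun i j : Fin 2 => if i.val + j.val + 1 = 2 then (1 : L) else 0) (wl i))),
          fderiv ℝ (fun d' => g' (d', fun i => (((h i * T i (x.1 i) * (h i)⁻¹ : ↥(archLocal L 2 _ (wl i))) : GL (Fin 2) ℂ) : Matrix (Fin 2) (Fin 2) ℂ))) x.2 (bV j)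
            ∂(Measure.pi ν), hg'', hg0'', fun ψ d => rfl, ?_⟩
      rw [List.map_cons, List.foldr_cons, hb_inr]
      rw [hb_inr] at h1
      have h2 := dirDeriv_foldr_comm_eqOn hU (((0 : ι → ℝ), bV j)) (σ.map fun i => ((Pi.single i (1 : ℝ) : ι → ℝ), (0 : V))) hF's
      have h3 : EqOn (fun x => fderiv ℝ F' x ((0 : ι → ℝ), bV j)) (fun x => (∏ i, 2 * Real.sin (x.1 i)) •
          ∫ h : (∀ i, ↥(archLocal L 2 (Matrix.of fun i j : Fin 2 => if i.val + j.val + 1 = 2 then (1 : L) else 0) (wl i))),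
            fderiv ℝ (fun d' => g' (d', fun i => (((h i * T i (x.1 i) * (h i)⁻¹ : ↥(archLocal L 2 _ (wl i))) : GL (Fin 2) ℂ) : Matrix (Fin 2) (Fin 2) ℂ))) x.2 (bV j)
              ∂(Measure.pi ν)) {x | ∀ i, Real.sin (x.1 i) ≠ 0} :=
        fderiv_torusFunctional_inr_eqOn L wl ν T hTs hTp hK hg' hg0' hF' (bV j) (fun ψ d => rfl)
      exact h1.trans (h2.trans (foldr_dirDeriv_eqOn_of_eqOn hU _ h3))

/-- **Order-zero bound of one mixed word near the corner, uniformly in the smooth parameters**, from the engine's `ψ`-section bounds `hInv` (§4 normal form; the `ψ`-word of `F′` at `(ψ, d)` is the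
jet of the section `F′(·, d)` on `Pi.single` tuples, ★ `norm_foldr_dirDeriv_inl_eq_norm_iteratedFDeriv_section`; `min`∕`max` over the `2^k` sign orthants).
[cite: Varadarajan1989, §6.4 Thm 22] [cite: Bouaziz1994IntegralesOrbitales, §3.1 (I₂) p. 579] [cite: HormanderALPDO1, §1.1 Thms. 1.1.6–1.1.9] -/
theorem exists_forall_norm_foldr_torusFunctional_le {K₁ : Set V}
    (hInv : ∀ g' : V × (ι → Matrix (Fin 2) (Fin 2) ℂ) → E, ContDiff ℝ ∞ g' → (∀ d, ∀ Y ∉ K, g' (d, Y) = 0) →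
      ∀ (n : ℕ) (σ : Fin n → ι) (ε : ι → Bool), ∃ δ > (0 : ℝ), ∃ B : ℝ, ∀ d ∈ K₁, ∀ ψ : ι → ℝ,
        (∀ i, 0 < (if ε i then ψ i else -ψ i) ∧ (if ε i then ψ i else -ψ i) < δ) →
          ‖iteratedFDeriv ℝ n (fun ψ' : ι → ℝ => (∏ i, 2 * Real.sin (ψ' i)) •
            ∫ h : (∀ i, ↥(archLocal L 2 (Matrix.of fun i j : Fin 2 => if i.val + j.val + 1 = 2 then (1 : L) else 0) (wl i))),
              g' (d, fun i => (((h i * T i (ψ' i) * (h i)⁻¹ : ↥(archLocal L 2 _ (wl i))) : GL (Fin 2) ℂ) : Matrix (Fin 2) (Fin 2) ℂ)) ∂(Measure.pi ν)) ψ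
            (fun j => Pi.single (σ j) (1 : ℝ))‖ ≤ B)
    {g : V × (ι → Matrix (Fin 2) (Fin 2) ℂ) → E} (hg : ContDiff ℝ ∞ g) (hg0 : ∀ d, ∀ Y ∉ K, g (d, Y) = 0)
    {F : (ι → ℝ) × V → E} (hF : ∀ ψ d, F (ψ, d) = (∏ i, 2 * Real.sin (ψ i)) •
      ∫ h : (∀ i, ↥(archLocal L 2 (Matrix.of fun i j : Fin 2 => if i.val + j.val + 1 = 2 then (1 : L) else 0) (wl i))),
        g (d, fun i => (((h i * T i (ψ i) * (h i)⁻¹ : ↥(archLocal L 2 _ (wl i))) : GL (Fin 2) ℂ) : Matrix (Fin 2) (Fin 2) ℂ)) ∂(Measure.pi ν))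
    (l : List (ι ⊕ κ)) :
    ∃ δ > (0 : ℝ), ∃ B : ℝ, ∀ d ∈ K₁, ∀ ψ : ι → ℝ, (∀ i, 0 < |ψ i| ∧ |ψ i| < δ) →
      ‖(l.map fun s => (((Pi.basisFun ℝ ι).prod bV) s : (ι → ℝ) × V)).foldr (fun v h y => fderiv ℝ h y v) F (ψ, d)‖ ≤ B := by
  have hU : IsOpen {x : (ι → ℝ) × V | ∀ i, Real.sin (x.1 i) ≠ 0} := by
    have h : {x : (ι → ℝ) × V | ∀ i, Real.sin (x.1 i) ≠ 0} = ⋂ i, (fun x : (ι → ℝ) × V => Real.sin (x.1 i)) ⁻¹' {0}ᶜ := by ext x; simp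
    rw [h]
    exact isOpen_iInter_of_finite fun i => (Real.continuous_sin.comp ((continuous_apply i).comp continuous_fst)).isOpen_preimage _ isOpen_compl_singleton
  obtain ⟨σ, g', F', hg', hg0', hF', heq⟩ := exists_psiWord_eqOn_word_torusFunctional L wl ν T hTs hTp bV hK hg hg0 hF l
  have hF's : ContDiffOn ℝ ∞ F' {x | ∀ i, Real.sin (x.1 i) ≠ 0} := contDiffOn_torusFunctional L wl ν T hTs hTp hK hg' hg0' hF'
  -- the engine, for every sign orthant
  choose δf hδf Bf hBf using fun ε : ι → Bool => hInv g' hg' hg0' σ.length (fun j => σ.get j) ε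
  refine ⟨min 1 (Finset.univ.inf' Finset.univ_nonempty δf), lt_min one_pos ((Finset.lt_inf'_iff _).2 fun ε _ => hδf ε),
    Finset.univ.sup' Finset.univ_nonempty Bf, fun d hd ψ hψ => ?_⟩
  -- `(ψ, d)` is off the walls
  have hx : ((ψ, d) : (ι → ℝ) × V) ∈ {x : (ι → ℝ) × V | ∀ i, Real.sin (x.1 i) ≠ 0} := by
    intro i
    obtain ⟨h0, h1⟩ := hψ i
    have h1' : |ψ i| < 1 := h1.trans_le (min_le_left _ _)
    have hπ : (1 : ℝ) < Real.pi := by linarith [Real.pi_gt_three]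
    rw [Ne, Real.sin_eq_zero_iff_of_lt_of_lt (by linarith [neg_abs_le (ψ i)]) (by linarith [le_abs_self (ψ i)])]
    exact abs_pos.1 h0
  rw [heq hx]
  -- the `ψ`-word of `F′` at `(ψ, d)` is the jet of the section on `Pi.single` tuples
  have hword : (σ.map fun i => ((Pi.single i (1 : ℝ) : ι → ℝ), (0 : V))) =
      (List.ofFn fun j : Fin σ.length => (Pi.single (σ.get j) (1 : ℝ) : ι → ℝ)).map fun u => ((u, 0) : (ι → ℝ) × V) := by
    apply List.ext_getElem <;> simp
  rw [hword, norm_foldr_dirDeriv_inl_eq_norm_iteratedFDeriv_section hU hF's hx]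
  have hsec : (fun ψ' : ι → ℝ => F' (ψ', d)) = fun ψ' => (∏ i, 2 * Real.sin (ψ' i)) •
      ∫ h : (∀ i, ↥(archLocal L 2 (Matrix.of fun i j : Fin 2 => if i.val + j.val + 1 = 2 then (1 : L) else 0) (wl i))),
        g' (d, fun i => (((h i * T i (ψ' i) * (h i)⁻¹ : ↥(archLocal L 2 _ (wl i))) : GL (Fin 2) ℂ) : Matrix (Fin 2) (Fin 2) ℂ)) ∂(Measure.pi ν) :=
    funext fun ψ' => hF' ψ' d
  rw [hsec]
  -- the orthant of `ψ`
  set ε : ι → Bool := fun i => decide (0 < ψ i) with hε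
  have hψε : ∀ i, 0 < (if ε i then ψ i else -ψ i) ∧ (if ε i then ψ i else -ψ i) < δf ε := by
    intro i
    obtain ⟨h0, h1⟩ := hψ i
    have h1' : |ψ i| < δf ε := h1.trans_le ((min_le_right _ _).trans (Finset.inf'_le _ (Finset.mem_univ ε)))
    by_cases hp : 0 < ψ i
    · have : ε i = true := by simp [hε, hp]
      simp only [this, ↓reduceIte]
      rw [← abs_of_pos hp]
      exact ⟨h0, h1'⟩
    · have : ε i = false := by simp [hε, hp]
      have hneg : ψ i < 0 := lt_of_le_of_ne (not_lt.1 hp) (fun h => (abs_pos.1 h0) h)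
      simp only [this, Bool.false_eq_true, ↓reduceIte]
      rw [← abs_of_neg hneg]
      exact ⟨h0, h1'⟩
  exact (hBf ε d hd ψ hψε).trans (Finset.le_sup' Bf (Finset.mem_univ ε))

/-- **HEAD — ALL JETS OF THE `k`-FOLD FUNCTIONAL NEAR THE CORNER, UNIFORMLY IN THE SMOOTH PARAMETERS, FROM THE ENGINE'S `ψ`-SECTION BOUNDS.**  If for every jointly `C^∞`, `K`-supported
integrand `g′` the jets of the `ψ`-sections `ψ ↦ F[g′](ψ, d)` on basis tuples are bounded on some open orthant cube at the corner, uniformly in `d ∈ K₁` (`hInv`: the conclusion of the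
`k`-fold Casimir engine `Inv ι` of (α4-S6), read at `P := ↥K₁`, `Q := V`), then for every `n`: **`∃ δ > 0, ∃ B, ∀ d ∈ K₁, ∀ ψ, (∀ i, 0 < |ψᵢ| < δ) → ‖iteratedFDeriv ℝ n F (ψ, d)‖ ≤ B`**
(★ order-zero reduction over the product basis + the word bounds). [cite: Varadarajan1989, §6.4 Thms 22–23] [cite: Bouaziz1994IntegralesOrbitales, §3.1 (I₂) p. 579]
[cite: HormanderALPDO1, §1.1 Thms. 1.1.6–1.1.9] -/
theorem exists_forall_norm_iteratedFDeriv_torusFunctional_le {K₁ : Set V}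
    (hInv : ∀ g' : V × (ι → Matrix (Fin 2) (Fin 2) ℂ) → E, ContDiff ℝ ∞ g' → (∀ d, ∀ Y ∉ K, g' (d, Y) = 0) →
      ∀ (n : ℕ) (σ : Fin n → ι) (ε : ι → Bool), ∃ δ > (0 : ℝ), ∃ B : ℝ, ∀ d ∈ K₁, ∀ ψ : ι → ℝ,
        (∀ i, 0 < (if ε i then ψ i else -ψ i) ∧ (if ε i then ψ i else -ψ i) < δ) →
          ‖iteratedFDeriv ℝ n (fun ψ' : ι → ℝ => (∏ i, 2 * Real.sin (ψ' i)) •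
            ∫ h : (∀ i, ↥(archLocal L 2 (Matrix.of fun i j : Fin 2 => if i.val + j.val + 1 = 2 then (1 : L) else 0) (wl i))),
              g' (d, fun i => (((h i * T i (ψ' i) * (h i)⁻¹ : ↥(archLocal L 2 _ (wl i))) : GL (Fin 2) ℂ) : Matrix (Fin 2) (Fin 2) ℂ)) ∂(Measure.pi ν)) ψ
            (fun j => Pi.single (σ j) (1 : ℝ))‖ ≤ B)
    {g : V × (ι → Matrix (Fin 2) (Fin 2) ℂ) → E} (hg : ContDiff ℝ ∞ g) (hg0 : ∀ d, ∀ Y ∉ K, g (d, Y) = 0)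
    {F : (ι → ℝ) × V → E} (hF : ∀ ψ d, F (ψ, d) = (∏ i, 2 * Real.sin (ψ i)) •
      ∫ h : (∀ i, ↥(archLocal L 2 (Matrix.of fun i j : Fin 2 => if i.val + j.val + 1 = 2 then (1 : L) else 0) (wl i))),
        g (d, fun i => (((h i * T i (ψ i) * (h i)⁻¹ : ↥(archLocal L 2 _ (wl i))) : GL (Fin 2) ℂ) : Matrix (Fin 2) (Fin 2) ℂ)) ∂(Measure.pi ν))
    (n : ℕ) :
    ∃ δ > (0 : ℝ), ∃ B : ℝ, ∀ d ∈ K₁, ∀ ψ : ι → ℝ, (∀ i, 0 < |ψ i| ∧ |ψ i| < δ) → ‖iteratedFDeriv ℝ n F (ψ, d)‖ ≤ B := by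
  have hU : IsOpen {x : (ι → ℝ) × V | ∀ i, Real.sin (x.1 i) ≠ 0} := by
    have h : {x : (ι → ℝ) × V | ∀ i, Real.sin (x.1 i) ≠ 0} = ⋂ i, (fun x : (ι → ℝ) × V => Real.sin (x.1 i)) ⁻¹' {0}ᶜ := by ext x; simp
    rw [h]
    exact isOpen_iInter_of_finite fun i => (Real.continuous_sin.comp ((continuous_apply i).comp continuous_fst)).isOpen_preimage _ isOpen_compl_singleton
  have hFs : ContDiffOn ℝ ∞ F {x | ∀ i, Real.sin (x.1 i) ≠ 0} := contDiffOn_torusFunctional L wl ν T hTs hTp hK hg hg0 hF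
  obtain ⟨C, hC0, hC⟩ := exists_forall_norm_iteratedFDeriv_le_pow_mul_sum_norm_foldr (F := E) ((Pi.basisFun ℝ ι).prod (Module.finBasis ℝ V))
  -- `(ψ, d)` with `0 < |ψᵢ| < 1` is off the walls
  have hxU : ∀ (d : V) (ψ : ι → ℝ), (∀ i, 0 < |ψ i| ∧ |ψ i| < 1) → ((ψ, d) : (ι → ℝ) × V) ∈ {x : (ι → ℝ) × V | ∀ i, Real.sin (x.1 i) ≠ 0} := by
    intro d ψ hψ i
    obtain ⟨h0, h1⟩ := hψ i
    have hπ : (1 : ℝ) < Real.pi := by linarith [Real.pi_gt_three]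
    rw [Ne, Real.sin_eq_zero_iff_of_lt_of_lt (by linarith [neg_abs_le (ψ i)]) (by linarith [le_abs_self (ψ i)])]
    exact abs_pos.1 h0
  -- the word list of ★'s reduction is `(List.ofFn I).map b`
  have hlist : ∀ I : Fin n → ι ⊕ Fin (Module.finrank ℝ V), (List.ofFn fun k => (((Pi.basisFun ℝ ι).prod (Module.finBasis ℝ V)) (I k) : (ι → ℝ) × V)) =
      (List.ofFn I).map fun s => (((Pi.basisFun ℝ ι).prod (Module.finBasis ℝ V)) s : (ι → ℝ) × V) := fun I => by
    rw [List.map_ofFn]; rfl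
  rcases isEmpty_or_nonempty (Fin n → ι ⊕ Fin (Module.finrank ℝ V)) with he | hne
  · refine ⟨1, one_pos, 0, fun d hd ψ hψ => ?_⟩
    have h := hC n hU hFs (hxU d ψ hψ)
    rw [Finset.univ_eq_empty, Finset.sum_empty, mul_zero] at h
    exact h
  · choose δI hδI BI hBI using fun I : Fin n → ι ⊕ Fin (Module.finrank ℝ V) =>
      exists_forall_norm_foldr_torusFunctional_le L wl ν T hTs hTp (Module.finBasis ℝ V) hK hInv hg hg0 hF (List.ofFn I)
    refine ⟨min 1 (Finset.univ.inf' Finset.univ_nonempty δI), lt_min one_pos ((Finset.lt_inf'_iff _).2 fun I _ => hδI I),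
      C ^ n * ∑ I : Fin n → ι ⊕ Fin (Module.finrank ℝ V), BI I, fun d hd ψ hψ => ?_⟩
    have hψ1 : ∀ i, 0 < |ψ i| ∧ |ψ i| < 1 := fun i => ⟨(hψ i).1, (hψ i).2.trans_le (min_le_left _ _)⟩
    refine (hC n hU hFs (hxU d ψ hψ1)).trans (mul_le_mul_of_nonneg_left (Finset.sum_le_sum fun I _ => ?_) (pow_nonneg hC0 n))
    rw [hlist I]
    exact hBI I d hd ψ fun i => ⟨(hψ i).1, (hψ i).2.trans_le ((min_le_right _ _).trans (Finset.inf'_le _ (Finset.mem_univ I)))⟩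

end Jets

end Literature.NumberTheory.Automorphic.UnitaryGroup

end
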